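import Summits.AtomisticToContinuum.Crystallization.Theorems.ChartedZeroExcessLayeredLatticeLiouvilleN

/-!
# ChartedZeroExcessLayered · LatticeLiouville — part O: §H «MinimisingDoor» after census TAG 174 JOHN-RADIUS — CONFORMAL (zero-strain)
LOCALISATION of the GSC column and the John-perturbative pieces typed ON THE CERTIFIED CORE TUBE (decomp-a2c lens-2 generation 27; NEW content,
imports part N)

CENSUS TAG 174 (J174.md a27f7f2d, kit j344072): the Lennard-Jones lattice Hessian is positive on the (1/16)-clean tube ONLY THINLY and only if the
tube carries the homogeneous W/P window (min λ_rel ≈ 0.003–0.10 at the c-axis-TENSION / shear corner; NEGATIVE Bloch eigenvalues just outside, at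
states whose two-shell misfit is still < 1/16), while on the CORE sub-window (spacing within 3 % of a⋆, layer gap within 1/40, shears ≤ 3 %) it
retains ≥ 52 % of the crystal stiffness.  A merely STATIONARY (Nash) door set may sit anywhere in the clean window at every scale (internally
relaxed uniformly strained stackings are stationary), so the Nash-door pieces K / H_pert are perturbative only in John's thin convexity form.  A
MINIMISING (e⋆-GSC) door set cannot: `BindingSurface` bounds its window excess by `C₁R²`, so far-out windows are ground-state-like — unstrained and
at the optimal scale — i.e. INSIDE THE CORE TUBE, where TAG 174 certifies positivity with margin ×0.52.  This file TYPES that localisation and the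
John-perturbative pieces on the core tube, and PROVES that together they give back K_G and H_pert,G:

* chart vocabulary: `IsConfChart a s L` (the chart is `s`-CONFORMAL about the scale `a`: `‖L − a•Q‖ ≤ s·a` for a linear isometry `Q`), `IsCoreStack a s L w`
  (the layer translations are an `s`-ideal Barlow stacking presentation: hollow-site registry, gaps within `s` of `√(2/3)` — gaps and registry live in the
  free `w` of `LayeredHom`, so conformality of `L` alone would leave c-axis strain and interlayer shear free), and the core-tube flatness currencies `NearHomL2BDC a s Λ κ r S Q` / `NearHomL2SupBDC a s Λ κ τ₀ r S Q` (= the tree's `NearHomL2BD` / part I's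
  `NearHomL2SupBD` with the conformality clause added to the chart; `nearHomL2BD_of_conf`, `nearHomL2SupBD_of_conf` drop it); ★ the clause has
  teeth: `IsConfChart.apply_bounds` — every direction is stretched by a factor in `a·[1 − s, 1 + s]` (PROVED), which no operator-norm class `Λ` expresses;
* Z «ConformalLocalisationPG aHi Λ θ s» and Z^sup «ConformalLocalisationSupPG aHi Λ θ s» — ZERO-STRAIN LOCALISATION BY MINIMALITY: for every δ
  there are a scale `a > 0`, a level ceiling `η_z > 0` and a floor `R_z > 0` such that on θ-good GSC door sets every `η`-flat root window
  (`η ≤ η_z`, `R ≥ R_z`) is `η`-flat under a CORE-TUBE chart about `a` (same level; sup clause kept in the Sup version)  [ENERGY-type: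
  `BindingSurface` + the energy gap of the clean tube + bulk/uniaxial elastic positivity AT THE OPTIMUM; UNDECIDED · TRUE-type · ATTACKABLE·L;
  not available for the Nash door];
* K_G^c «CoreExclusionPGC aHi Λ θ s», H_pert,G^c «PerturbativeDecayPGC aHi Λ θ s» — K_G / H_pert,G with the flatness HYPOTHESIS restricted to
  core-tube charts (about every scale `a`; conclusions unchanged): the John-perturbative statements ON THE CORE TUBE  [ATTACKABLE·XL; John
  input = Hessian positivity on the core tube about the optimal scale: TAG 174 (a) core sub-window ⊇ the `s = 1/50` tube, λ_rel ≥ 0.52, SUPPORTED];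
  WEAKER-or-equal than K_G / H_pert,G (`coreExclusionPGC_of_PG`, `perturbativeDecayPGC_of_PG`, PROVED);
* ★ glue (PROVED): `coreExclusionPG_of_conf : ConformalLocalisationPG → CoreExclusionPGC → CoreExclusionPG`,
  `perturbativeDecayPG_of_conf : ConformalLocalisationSupPG → PerturbativeDecayPGC → PerturbativeDecayPG` (every aHi, Λ, θ, s);
* ★ columns `gap_and_pert_1_50_of_certs_16XGc` (s = 1/50, inside the certified core): `LatticeLiouvilleCert → LayeredLiouvilleCert → R_G →
  X → Z → Z^sup → K_G^c → H_pert,G^c → PeriodicBulkGapDoor 2 → VisibleGap (1/50) ∧ PertRegime (1/50)` and its resolved twelve-leaf form.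
Why each new piece is strictly weaker than what it replaces: K_G^c / H_pert,G^c drop every window whose chart is strained, off-scale, gap-stretched
or registry-sheared by more than `s` (where TAG 174 finds the thin and the negative Hessians); Z / Z^sup are far-field asymptotic statements about minimisers only, implied in
substance by N (exact layering ⇒ exact optimal-scale charts) and saying nothing about cores, decay or periodicity.
No sorry, no instance/notation/set_option; axioms standard.
-/

noncomputable section

open scoped BigOperators InnerProductSpace RealInnerProductSpace
open MeasureTheory Set Metric Filter Topology
open Summit.AtomisticToContinuum.Crystallization.Theorems.ChartedPlanarOrderRigidityDoor
  (E3 IsClean IsNash IsCharted IsEStarGSC VisibleGap PertRegime atomsIn siteEnergy eStar BindingSurface)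
open Summit.AtomisticToContinuum.Crystallization.Theorems.ChartedPlanarOrderDensityDichotomy (μS IsSep nK nK_nonneg excess)
open Summit.AtomisticToContinuum.Crystallization.Theorems.ChartedPlanarOrderMesoCut (IsDoorSet NearHom LayeredHom EnvClose)
open Summit.AtomisticToContinuum.Crystallization.Theorems.OverbindingBudgetLiouvilleDictionary (NearHomBD)
open Summit.AtomisticToContinuum.Crystallization.Theorems.ChartedPlanarOrderDoorLayered
  (TwoPeriodic DoorPeriodic PeriodicBulkGapDoor gap_and_pert_1_50_of_periodic NearHomL2BD nearHomL2BD_mono nearHomBD_of_nearHomL2BD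
   sq_le_finsum_mem not_nearHomL2BD_singleton envClose_mono)
open Summit.AtomisticToContinuum.Crystallization.Theorems.ChartedPlanarOrderDoorLayeredOsc (IsTwoShellAffineGood DoorPeriodicOsc)
open Summit.AtomisticToContinuum.Crystallization.Theorems.ChartedPlanarOrderCleanScaleP
  (IsCleanP IsDoorSetP DoorPeriodicP isDoorSetP_mono doorPeriodic_of_doorPeriodicP isDoorSetP_one_iff doorPeriodicP_one_iff)
open Literature.MathematicalPhysics.StatisticalMechanics (haggLabel barlowOffset layerNormal IsHaggSeq)

namespace Summit.AtomisticToContinuum.Crystallization.Theorems.ChartedZeroExcessLayeredLatticeLiouville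

/-! ## §H.1  Conformal charts and the conformal flatness currencies -/

/-- `IsConfChart a s L`: the chart `L` is `s`-CONFORMAL about the scale `a` — within `s·a` in operator norm of `a•Q` for some linear isometry
`Q` of `E3` (no deviatoric strain and no scale error beyond the relative tolerance `s`). [this file, g27] -/
def IsConfChart (a s : ℝ) (L : E3 →L[ℝ] E3) : Prop :=
  ∃ Q : E3 ≃ₗᵢ[ℝ] E3, ‖L - a • (Q.toContinuousLinearEquiv : E3 →L[ℝ] E3)‖ ≤ s * a

/-- sanity: an exact similarity `a•Q` is `s`-conformal about `a` for every `s ≥ 0`, `a ≥ 0`. [this file, g27] -/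
theorem isConfChart_smul (Q : E3 ≃ₗᵢ[ℝ] E3) {a s : ℝ} (ha : 0 ≤ a) (hs : 0 ≤ s) :
    IsConfChart a s (a • (Q.toContinuousLinearEquiv : E3 →L[ℝ] E3)) :=
  ⟨Q, by simpa using mul_nonneg hs ha⟩

/-- conformality is monotone in the tolerance. [this file, g27] -/
theorem IsConfChart.mono {a s s' : ℝ} {L : E3 →L[ℝ] E3} (h : IsConfChart a s L) (hs : s ≤ s') (ha : 0 ≤ a) : IsConfChart a s' L := by
  obtain ⟨Q, hQ⟩ := h
  exact ⟨Q, hQ.trans (mul_le_mul_of_nonneg_right hs ha)⟩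

/-- ★ THE CLAUSE HAS TEETH: an `s`-conformal chart about `a` stretches EVERY direction by a factor in `a·[1 − s, 1 + s]` — it pins scale and excludes
deviatoric strain beyond `s`, which the operator-norm class `‖L‖, ‖L⁻¹‖ ≤ Λ` of the tree currencies cannot (Λ = 2 admits every strain up to 100 %; even Λ = 1.08
still admits the TAG-174 tension states). [this file, g27] -/
theorem IsConfChart.apply_bounds {a s : ℝ} {L : E3 →L[ℝ] E3} (h : IsConfChart a s L) (ha : 0 ≤ a) (x : E3) :
    (1 - s) * a * ‖x‖ ≤ ‖L x‖ ∧ ‖L x‖ ≤ (1 + s) * a * ‖x‖ := by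
  obtain ⟨Q, hQ⟩ := h
  have hQx : ‖(a • (Q.toContinuousLinearEquiv : E3 →L[ℝ] E3)) x‖ = a * ‖x‖ := by
    simp [norm_smul, abs_of_nonneg ha]
  have hD : ‖(L - a • (Q.toContinuousLinearEquiv : E3 →L[ℝ] E3)) x‖ ≤ s * a * ‖x‖ :=
    (ContinuousLinearMap.le_opNorm _ x).trans (mul_le_mul_of_nonneg_right hQ (norm_nonneg x))
  have hsplit : L x = (a • (Q.toContinuousLinearEquiv : E3 →L[ℝ] E3)) x + (L - a • (Q.toContinuousLinearEquiv : E3 →L[ℝ] E3)) x := by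
    simp
  constructor
  · have := norm_sub_norm_le ((a • (Q.toContinuousLinearEquiv : E3 →L[ℝ] E3)) x) (-((L - a • (Q.toContinuousLinearEquiv : E3 →L[ℝ] E3)) x))
    have h2 : ‖(a • (Q.toContinuousLinearEquiv : E3 →L[ℝ] E3)) x - -((L - a • (Q.toContinuousLinearEquiv : E3 →L[ℝ] E3)) x)‖ = ‖L x‖ := by
      rw [sub_neg_eq_add, ← hsplit]
    rw [h2, norm_neg, hQx] at this
    nlinarith [hD, this]
  · calc ‖L x‖ = ‖(a • (Q.toContinuousLinearEquiv : E3 →L[ℝ] E3)) x + (L - a • (Q.toContinuousLinearEquiv : E3 →L[ℝ] E3)) x‖ := by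
          rw [← hsplit]
      _ ≤ ‖(a • (Q.toContinuousLinearEquiv : E3 →L[ℝ] E3)) x‖ + ‖(L - a • (Q.toContinuousLinearEquiv : E3 →L[ℝ] E3)) x‖ := norm_add_le _ _
      _ ≤ a * ‖x‖ + s * a * ‖x‖ := by rw [hQx]; linarith [hD]
      _ = (1 + s) * a * ‖x‖ := by ring

/-- `IsCoreStack a s L w`: the per-layer translations `w` of the layered chart `LayeredHom L w` are within `s·a` of an IDEAL BARLOW STACKING presentation
transported by `L` — hollow-site registry `haggLabel lab m • barlowOffset 1` for a Hägg word `lab` and heights `z m • layerNormal 1` whose consecutive GAPS are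
within `s` of the ideal `√(2/3)` (reference units: in-plane spacing `1`).  Together with `IsConfChart a s L` this pins the chart to the CORE TUBE: in-plane scale
and shear (via `L`), layer gaps and interlayer registry / shear (via `w`) — the census TAG 174 (a) core sub-window; without it the gaps and the registry, which
live in the free `w` of `LayeredHom`, would stay unconstrained (c-axis tension, interlayer shear). [this file, g27] -/
def IsCoreStack (a s : ℝ) (L : E3 →L[ℝ] E3) (w : ℤ → E3) : Prop :=
  ∃ (lab : ℤ → ℤ) (z : ℤ → ℝ), IsHaggSeq lab ∧
    (∀ m : ℤ, ‖w m - L (((haggLabel lab m : ℝ) • barlowOffset 1) + (z m • layerNormal 1))‖ ≤ s * a) ∧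
    ∀ m : ℤ, |z (m + 1) - z m - Real.sqrt (2 / 3)| ≤ s

/-- sanity: the exact Barlow presentation with ideal gaps is a core stack for every `s ≥ 0`, `a ≥ 0`. [this file, g27] -/
theorem isCoreStack_ideal {a s : ℝ} (ha : 0 ≤ a) (hs : 0 ≤ s) (L : E3 →L[ℝ] E3) {lab : ℤ → ℤ} (hlab : IsHaggSeq lab) :
    IsCoreStack a s L (fun m => L (((haggLabel lab m : ℝ) • barlowOffset 1) + (((m : ℝ) * Real.sqrt (2 / 3)) • layerNormal 1))) := by
  refine ⟨lab, fun m => (m : ℝ) * Real.sqrt (2 / 3), hlab, fun m => ?_, fun m => ?_⟩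
  · simpa using mul_nonneg hs ha
  · have : ((m + 1 : ℤ) : ℝ) * Real.sqrt (2 / 3) - (m : ℝ) * Real.sqrt (2 / 3) - Real.sqrt (2 / 3) = 0 := by push_cast; ring
    rw [this, abs_zero]; exact hs

/-- **`NearHomL2BDC a s Λ κ r S Q`** — `NearHomL2BD Λ κ r S Q` (tree, verbatim) with the chart additionally ON THE CORE TUBE: `L` `s`-conformal about the scale `a`
and the layer translations `w` an `s`-ideal Barlow stacking presentation (`IsCoreStack`). [this file, g27] -/
def NearHomL2BDC (a s Λ κ r : ℝ) (S Q : Set E3) : Prop :=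
  ∃ (L : E3 ≃L[ℝ] E3), ‖(L : E3 →L[ℝ] E3)‖ ≤ Λ ∧ ‖(L.symm : E3 →L[ℝ] E3)‖ ≤ Λ ∧ IsConfChart a s (L : E3 →L[ℝ] E3) ∧
    ∃ (w : ℤ → E3) (Ψ : E3 → E3) (τ : E3 → ℝ), IsCoreStack a s (L : E3 →L[ℝ] E3) w ∧ Set.InjOn Ψ Q ∧ Set.MapsTo Ψ Q (LayeredHom (L : E3 →L[ℝ] E3) w) ∧
      (∀ x ∈ Q, 0 ≤ τ x ∧ EnvClose (τ x) r S x (LayeredHom (L : E3 →L[ℝ] E3) w) (Ψ x)) ∧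
      ∑ᶠ x ∈ Q, τ x ^ 2 ≤ κ * nK Q

/-- **`NearHomL2SupBDC a s Λ κ τ₀ r S Q`** — part I's `NearHomL2SupBD Λ κ τ₀ r S Q` (verbatim) with the chart additionally on the core tube (`IsConfChart` +
`IsCoreStack`). [this file, g27] -/
def NearHomL2SupBDC (a s Λ κ τ₀ r : ℝ) (S Q : Set E3) : Prop :=
  ∃ (L : E3 ≃L[ℝ] E3), ‖(L : E3 →L[ℝ] E3)‖ ≤ Λ ∧ ‖(L.symm : E3 →L[ℝ] E3)‖ ≤ Λ ∧ IsConfChart a s (L : E3 →L[ℝ] E3) ∧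
    ∃ (w : ℤ → E3) (Ψ : E3 → E3) (τ : E3 → ℝ), IsCoreStack a s (L : E3 →L[ℝ] E3) w ∧ Set.InjOn Ψ Q ∧ Set.MapsTo Ψ Q (LayeredHom (L : E3 →L[ℝ] E3) w) ∧
      (∀ x ∈ Q, 0 ≤ τ x ∧ τ x ≤ τ₀ ∧ EnvClose (τ x) r S x (LayeredHom (L : E3 →L[ℝ] E3) w) (Ψ x)) ∧
      ∑ᶠ x ∈ Q, τ x ^ 2 ≤ κ * nK Q

/-- drop the conformality clause: `NearHomL2BDC ⇒ NearHomL2BD`. [this file, g27] -/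
theorem nearHomL2BD_of_conf {a s Λ κ r : ℝ} {S Q : Set E3} (h : NearHomL2BDC a s Λ κ r S Q) : NearHomL2BD Λ κ r S Q := by
  obtain ⟨L, hL, hL', _, w, Ψ, τ, _, hinj, hmaps, hτ, hsum⟩ := h
  exact ⟨L, hL, hL', w, Ψ, τ, hinj, hmaps, hτ, hsum⟩

/-- drop the conformality clause, sup version: `NearHomL2SupBDC ⇒ NearHomL2SupBD`. [this file, g27] -/
theorem nearHomL2SupBD_of_conf {a s Λ κ τ₀ r : ℝ} {S Q : Set E3} (h : NearHomL2SupBDC a s Λ κ τ₀ r S Q) : NearHomL2SupBD Λ κ τ₀ r S Q := by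
  obtain ⟨L, hL, hL', _, w, Ψ, τ, _, hinj, hmaps, hτ, hsum⟩ := h
  exact ⟨L, hL, hL', w, Ψ, τ, hinj, hmaps, hτ, hsum⟩

/-- the conformal currencies are monotone in the level. [this file, g27] -/
theorem nearHomL2BDC_mono {a s Λ κ κ' r : ℝ} (hκ : κ ≤ κ') {S Q : Set E3} (h : NearHomL2BDC a s Λ κ r S Q) : NearHomL2BDC a s Λ κ' r S Q := by
  obtain ⟨L, hL, hL', hc, w, Ψ, τ, hcs, hinj, hmaps, hτ, hsum⟩ := h
  exact ⟨L, hL, hL', hc, w, Ψ, τ, hcs, hinj, hmaps, hτ, hsum.trans (mul_le_mul_of_nonneg_right hκ (nK_nonneg Q))⟩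

/-- drop the sup clause inside the conformal currency: `NearHomL2SupBDC ⇒ NearHomL2BDC`. [this file, g27] -/
theorem nearHomL2BDC_of_supC {a s Λ κ τ₀ r : ℝ} {S Q : Set E3} (h : NearHomL2SupBDC a s Λ κ τ₀ r S Q) : NearHomL2BDC a s Λ κ r S Q := by
  obtain ⟨L, hL, hL', hc, w, Ψ, τ, hcs, hinj, hmaps, hτ, hsum⟩ := h
  exact ⟨L, hL, hL', hc, w, Ψ, τ, hcs, hinj, hmaps, fun x hx => ⟨(hτ x hx).1, (hτ x hx).2.2⟩, hsum⟩

/-! ## §H.2  Z «ConformalLocalisation» — zero-strain localisation by minimality (two currencies) -/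

/-- **Z(aHi; Λ, θ, s) «ConformalLocalisationPG»** — ZERO-STRAIN LOCALISATION BY MINIMALITY: for every δ there are a scale `a > 0`, a level ceiling
`η_z > 0` and a floor `R_z > 0` such that on every θ-good `aHi`-GSC-door set, every root window of radius `R ≥ R_z` that is `η`-flat in mean square
(`0 < η ≤ η_z`, chart distortion `≤ Λ`) is `η`-flat under a chart that is moreover ON THE CORE TUBE: `s`-CONFORMAL about `a` with an `s`-ideal
stacking presentation of its layer translations (gaps within `s` of `√(2/3)`, registry within `s·a` of the hollow sites).  ENERGY-type (`BindingSurface`: window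
excess `≤ C₁R²` ⇒ far-out windows of minimisers are ground-state-like; energy gap of the clean tube + elastic positivity at the optimum ⇒ their
charts are unstrained and at the optimal scale); not available for the Nash door (uniformly strained stationary crystals).  UNIFORMITY of
`η_z`, `R_z` (critic row 479 (iv)): the TOLERANCE `s > 0` is what makes the thresholds uniform and the level `η` exact — the η-fitting affine chart `L`
ITSELF is kept (its set-irrelevant normal column and the lattice-coset freedom of `w` re-presented, same point set, same misfits), and it qualifies
as soon as its in-plane scale error / strain, its gap errors and its registry offsets are `≤ s`; that follows uniformly from
«normalised excess ≤ C₁/(ρR)» (BindingSurface) + «mean misfit ≤ √η» through the HOMOGENEOUS ENERGY GAP of the clean window modulo similarities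
(`E_hom(L) − e⋆ ≥ c_W·dist(L, a⋆·O(3))²`, a zeroth-order landscape statement, certifiable; not Hessian positivity of strained states) and the
Lipschitz bound of the site energy in the environment misfit: `c_W·d(L)² ≤ C₁/(ρR) + C·η^{1/3}`, so `η_z(s)`, `R_z(s)` depend on `s, δ` only.  The
residual strain `e(R) → 0` of minimising windows is absorbed by the tolerance, not by the level; at `s = 0` (exact conformality) only the slack form
Z♭ «affine-η-flat ⇒ conformal-(η + ζ(R))-flat» would hold.  Why it might fail: optimal stackings of different scales/axial ratios beyond the tolerance
`s` (for LJ the fcc/hcp optimal spacings and c/a differ by ~10⁻⁴), or a clean homogeneous state off the optimum with energy `e⋆` (none known). [this file, g27] -/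
def ConformalLocalisationPG (aHi Λ θ s : ℝ) : Prop :=
  ∀ δ : ℝ, 0 < δ → ∃ a : ℝ, 0 < a ∧ ∃ ηz : ℝ, 0 < ηz ∧ ∃ Rz : ℝ, 0 < Rz ∧
    ∀ S : Set E3, IsDoorSetPG aHi δ S → (∀ q ∈ S, IsTwoShellAffineGood θ S q) →
      ∀ η : ℝ, 0 < η → η ≤ ηz → ∀ R : ℝ, Rz ≤ R →
        NearHomL2BD Λ η 4 S (atomsIn (μS S) 0 R) → NearHomL2BDC a s Λ η 4 S (atomsIn (μS S) 0 R)

/-- **Z^sup(aHi; Λ, θ, s) «ConformalLocalisationSupPG»** — the same localisation in the sup-and-mean-square currency of H_pert (sup level `τ₀`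
arbitrary and preserved). [this file, g27] -/
def ConformalLocalisationSupPG (aHi Λ θ s : ℝ) : Prop :=
  ∀ δ : ℝ, 0 < δ → ∃ a : ℝ, 0 < a ∧ ∃ ηz : ℝ, 0 < ηz ∧ ∃ Rz : ℝ, 0 < Rz ∧
    ∀ S : Set E3, IsDoorSetPG aHi δ S → (∀ q ∈ S, IsTwoShellAffineGood θ S q) →
      ∀ η : ℝ, 0 < η → η ≤ ηz → ∀ R : ℝ, Rz ≤ R → ∀ τ₀ : ℝ, 0 < τ₀ →
        NearHomL2SupBD Λ η τ₀ 4 S (atomsIn (μS S) 0 R) → NearHomL2SupBDC a s Λ η τ₀ 4 S (atomsIn (μS S) 0 R)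

/-! ## §H.3  K_G^c, H_pert,G^c — the John-perturbative pieces ON THE CONFORMAL (core) TUBE -/

/-- **K_G^c(aHi; Λ, θ, s) «CoreExclusionPGC»** — NO CORES IN MINIMISERS, CORE-TUBE FORM: K_G with its mean-square flatness hypothesis restricted
to CORE-TUBE charts (`s`-conformal about an arbitrary scale `a`, `s`-ideal stacking presentation; constants may depend on `a`; conclusion unchanged).
John input = Hessian positivity on the core tube (TAG 174 (a) core sub-window: spacing 3 %, gap 1/40, shears 3 % ⊇ the `s = 1/50` tube; λ_rel ≥ 0.52).  WEAKER-or-equal than K_G (`coreExclusionPGC_of_PG`). [this file, g27] -/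
def CoreExclusionPGC (aHi Λ θ s : ℝ) : Prop :=
  LatticeLiouvilleCert → LayeredLiouvilleCert → ∀ δ : ℝ, 0 < δ → ∀ a : ℝ, 0 < a → ∃ C : ℝ, 1 ≤ C ∧ ∃ M : ℝ, 1 ≤ M ∧ ∀ τ₀ : ℝ, 0 < τ₀ →
    ∃ κ₁ : ℝ, 0 < κ₁ ∧ ∃ R₀ : ℝ, 0 < R₀ ∧
      ∀ S : Set E3, IsDoorSetPG aHi δ S → (∀ q ∈ S, IsTwoShellAffineGood θ S q) →
        ∀ η : ℝ, 0 < η → η ≤ κ₁ → ∀ R : ℝ, R₀ ≤ R →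
          NearHomL2BDC a s Λ η 4 S (atomsIn (μS S) 0 (M * R)) → NearHomL2SupBD Λ (C * η) τ₀ 4 S (atomsIn (μS S) 0 R)

/-- **H_pert,G^c(aHi; Λ, θ, s) «PerturbativeDecayPGC»** — the perturbative decay step, CORE-TUBE FORM: H_pert,G with its sup-flatness hypothesis
restricted to core-tube charts (`s`-conformal about an arbitrary scale `a`, `s`-ideal stacking).  John input as for K_G^c; the linearised operator is the zero-strain `L_lay` of
`LayeredLiouvilleCert`.  WEAKER-or-equal than H_pert,G (`perturbativeDecayPGC_of_PG`). [this file, g27] -/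
def PerturbativeDecayPGC (aHi Λ θ s : ℝ) : Prop :=
  LatticeLiouvilleCert → LayeredLiouvilleCert → ∀ δ : ℝ, 0 < δ → ∀ a : ℝ, 0 < a → ∀ c : ℝ, 0 < c →
    ∃ τ₀ : ℝ, 0 < τ₀ ∧ ∃ κ₀ : ℝ, 0 < κ₀ ∧ ∃ M : ℝ, 1 ≤ M ∧ ∃ R₀ : ℝ, 0 < R₀ ∧
      ∀ S : Set E3, IsDoorSetPG aHi δ S → (∀ q ∈ S, IsTwoShellAffineGood θ S q) →
        ∀ η : ℝ, 0 < η → η ≤ κ₀ → ∀ R : ℝ, R₀ ≤ R →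
          NearHomL2SupBDC a s Λ η τ₀ 4 S (atomsIn (μS S) 0 (M * R)) → NearHomL2BD Λ (c * η) 4 S (atomsIn (μS S) 0 R)

/-- seam: K_G ⇒ K_G^c (restricting the hypothesis class weakens the piece). [this file, g27] -/
theorem coreExclusionPGC_of_PG {aHi Λ θ s : ℝ} (h : CoreExclusionPG aHi Λ θ) : CoreExclusionPGC aHi Λ θ s := by
  intro hL hL' δ hδ a _
  obtain ⟨C, hC, M, hM, hrest⟩ := h hL hL' δ hδ
  refine ⟨C, hC, M, hM, fun τ₀ hτ₀ => ?_⟩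
  obtain ⟨κ₁, hκ₁, R₀, hR₀, hS⟩ := hrest τ₀ hτ₀
  exact ⟨κ₁, hκ₁, R₀, hR₀, fun S hSd hg η hη hηle R hR hflat => hS S hSd hg η hη hηle R hR (nearHomL2BD_of_conf hflat)⟩

/-- seam: H_pert,G ⇒ H_pert,G^c. [this file, g27] -/
theorem perturbativeDecayPGC_of_PG {aHi Λ θ s : ℝ} (h : PerturbativeDecayPG aHi Λ θ) : PerturbativeDecayPGC aHi Λ θ s := by
  intro hL hL' δ hδ a _ c hc
  obtain ⟨τ₀, hτ₀, κ₀, hκ₀, M, hM, R₀, hR₀, hS⟩ := h hL hL' δ hδ c hc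
  exact ⟨τ₀, hτ₀, κ₀, hκ₀, M, hM, R₀, hR₀, fun S hSd hg η hη hηle R hR hflat => hS S hSd hg η hη hηle R hR (nearHomL2SupBD_of_conf hflat)⟩

/-! ## §H.4  ★ Glue: localisation ∧ core-tube piece ⇒ the GSC piece (PROVED) -/

/-- ★ **K_G ⟸ Z ∧ K_G^c**: zero-strain localisation and core exclusion on the conformal tube give core exclusion on GSC door sets. [this file, g27] -/
theorem coreExclusionPG_of_conf {aHi Λ θ s : ℝ} (hZ : ConformalLocalisationPG aHi Λ θ s) (hK : CoreExclusionPGC aHi Λ θ s) :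
    CoreExclusionPG aHi Λ θ := by
  intro hL hL' δ hδ
  obtain ⟨a, ha, ηz, hηz, Rz, hRz, hZ'⟩ := hZ δ hδ
  obtain ⟨C, hC, M, hM, hrest⟩ := hK hL hL' δ hδ a ha
  refine ⟨C, hC, M, hM, fun τ₀ hτ₀ => ?_⟩
  obtain ⟨κ₁, hκ₁, R₀, hR₀, hS⟩ := hrest τ₀ hτ₀
  refine ⟨min κ₁ ηz, lt_min hκ₁ hηz, max R₀ Rz, lt_max_of_lt_left hR₀, fun S hSd hg η hη hηle R hR hflat => ?_⟩
  have hR₀R : R₀ ≤ R := (le_max_left _ _).trans hR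
  have hRzR : Rz ≤ R := (le_max_right _ _).trans hR
  have hRpos : 0 < R := hRz.trans_le hRzR
  have hMR : Rz ≤ M * R := hRzR.trans (le_mul_of_one_le_left hRpos.le hM)
  have hconf : NearHomL2BDC a s Λ η 4 S (atomsIn (μS S) 0 (M * R)) :=
    hZ' S hSd hg η hη (hηle.trans (min_le_right _ _)) (M * R) hMR hflat
  exact hS S hSd hg η hη (hηle.trans (min_le_left _ _)) R hR₀R hconf

/-- ★ **H_pert,G ⟸ Z^sup ∧ H_pert,G^c**. [this file, g27] -/
theorem perturbativeDecayPG_of_conf {aHi Λ θ s : ℝ} (hZ : ConformalLocalisationSupPG aHi Λ θ s) (hP : PerturbativeDecayPGC aHi Λ θ s) :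
    PerturbativeDecayPG aHi Λ θ := by
  intro hL hL' δ hδ c hc
  obtain ⟨a, ha, ηz, hηz, Rz, hRz, hZ'⟩ := hZ δ hδ
  obtain ⟨τ₀, hτ₀, κ₀, hκ₀, M, hM, R₀, hR₀, hS⟩ := hP hL hL' δ hδ a ha c hc
  refine ⟨τ₀, hτ₀, min κ₀ ηz, lt_min hκ₀ hηz, M, hM, max R₀ Rz, lt_max_of_lt_left hR₀, fun S hSd hg η hη hηle R hR hflat => ?_⟩
  have hR₀R : R₀ ≤ R := (le_max_left _ _).trans hR
  have hRzR : Rz ≤ R := (le_max_right _ _).trans hR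
  have hRpos : 0 < R := hRz.trans_le hRzR
  have hMR : Rz ≤ M * R := hRzR.trans (le_mul_of_one_le_left hRpos.le hM)
  have hconf : NearHomL2SupBDC a s Λ η τ₀ 4 S (atomsIn (μS S) 0 (M * R)) :=
    hZ' S hSd hg η hη (hηle.trans (min_le_right _ _)) (M * R) hMR τ₀ hτ₀ hflat
  exact hS S hSd hg η hη (hηle.trans (min_le_left _ _)) R hR₀R hconf

/-! ## §H.5  ★ Columns `_16XGc` (core half-width `s = 1/50`, the TAG-174-certified core) -/

/-- ★★ **COLUMN `_16XGc`** (EIGHT opaque leaves + HBG″; the John input confined to the certified core tube):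
`LatticeLiouvilleCert → LayeredLiouvilleCert → R_G(1;2,1/16,1/16) → X(1;2,1/16,1/16) → Z(1;2,1/16,1/50) → Z^sup(1;2,1/16,1/50) →
K_G^c(1;2,1/16,1/50) → H_pert,G^c(1;2,1/16,1/50) → PeriodicBulkGapDoor 2 → VisibleGap (1/50) ∧ PertRegime (1/50)`. [this file, g27] -/
theorem gap_and_pert_1_50_of_certs_16XGc (hL : LatticeLiouvilleCert) (hL' : LayeredLiouvilleCert)
    (hR : OscRigidityL2BDPG 1 2 (1 / 16) (1 / 16)) (hX : ExcessFlatnessControlP 1 2 (1 / 16) (1 / 16))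
    (hZ : ConformalLocalisationPG 1 2 (1 / 16) (1 / 50)) (hZ' : ConformalLocalisationSupPG 1 2 (1 / 16) (1 / 50))
    (hK : CoreExclusionPGC 1 2 (1 / 16) (1 / 50)) (hPd : PerturbativeDecayPGC 1 2 (1 / 16) (1 / 50))
    (hG : PeriodicBulkGapDoor 2) : VisibleGap (1 / 50) ∧ PertRegime (1 / 50) :=
  gap_and_pert_1_50_of_certs_16XG hL hL' hR hX (coreExclusionPG_of_conf hZ hK) (perturbativeDecayPG_of_conf hZ' hPd) hG

/-- ★★ **COLUMN `_16XGc`, resolved form (the audit column)**: `LJDecay → LJMoments → CleanCrystalStability → LayeredDecay → LayeredMoments →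
LayeredCrystalStability → R_G → X → Z → Z^sup → K_G^c → H_pert,G^c → HBG″ → VisibleGap (1/50) ∧ PertRegime (1/50)`. [this file, g27] -/
theorem gap_and_pert_1_50_of_layered_pieces_16XGc (hD : LJDecay) (hM : LJMoments) (hC : CleanCrystalStability)
    (hD' : LayeredDecay) (hM' : LayeredMoments) (hC' : LayeredCrystalStability)
    (hR : OscRigidityL2BDPG 1 2 (1 / 16) (1 / 16)) (hX : ExcessFlatnessControlP 1 2 (1 / 16) (1 / 16))
    (hZ : ConformalLocalisationPG 1 2 (1 / 16) (1 / 50)) (hZ' : ConformalLocalisationSupPG 1 2 (1 / 16) (1 / 50))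
    (hK : CoreExclusionPGC 1 2 (1 / 16) (1 / 50)) (hPd : PerturbativeDecayPGC 1 2 (1 / 16) (1 / 50))
    (hG : PeriodicBulkGapDoor 2) : VisibleGap (1 / 50) ∧ PertRegime (1 / 50) :=
  gap_and_pert_1_50_of_certs_16XGc (latticeLiouvilleCert_of (latticeLinLiouville_of hD hM) hC) (layeredLiouvilleCert_of_pieces hD' hM' hC')
    hR hX hZ hZ' hK hPd hG

end Summit.AtomisticToContinuum.Crystallization.Theorems.ChartedZeroExcessLayeredLatticeLiouville

end
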